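import Summits.FinalStateConjecture.FinalStateConjecture.Statement
import Literature.Geometry.Lorentzian.ConvergenceTransport
import Literature.Geometry.Lorentzian.CauchyDevelopmentIsometryClasses
import Literature.Geometry.Lorentzian.RelativeDevelopmentGluingCauchy
import HarnessLib

/-!
# Route ZeroEnergyKerrOrBomb · crux `StationaryLimitReduction` (stmt-FinalStateConjecture-10021), line
# `one-locked-explosion` — TRANSPORT of the summit's settled-down conjunct along a time-orientation
# preserving isometric diffeomorphism of spacetimes

Helper file (`--supports stmt-FinalStateConjecture-10021`; registered helper `hasExhaustiveCharts_transport`)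
from the lead's wave-1 stub-worker for `stub_kerrLimitsAreGood` (lead prover-line-stmt-FinalStateConjecture-10021-0,
2026-08-16). For an isometric diffeomorphism `ψ : 𝓢₁ ≃ 𝓢₂` preserving the time orientations:
causal and chronological futures/pasts are carried by `ψ` (`image_causalFuture_eq`, `image_causalPast_eq`,
`image_chronologicalPast_eq`); slab deviations of a chart are unchanged by composing it with `ψ`
(`deviationCk_comp`, `truncDeviationCk_comp`, from the tree's `Spacetime.deviation_comp`), late charts stay
late charts (`isLateChart_comp`); hence an `N`-Kerr `FinalStateDecomposition 𝓢₁ O k` is transported to one of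
`𝓢₂` over `ψ '' O` with the same `N`, masses, spins and motions (`transportDecomposition`), with
`charted_/certifiedLate_/certifiedSlab_transportDecomposition` and exhaustiveness preserved
(`hasExhaustiveCharts_transportDecomposition`, binder-free form `hasExhaustiveCharts_transport`). Used by
`ZeroEnergyKerrOrBombStationaryLimitReductionOneDevelopment.lean` ("one maximal development serves all").
No named fact; nothing restated. References: O'Neill 1983, Ch. 3 (isometries), Ch. 14 (causality);
Dafermos–Luk arXiv:1710.01722, Conjecture 1.
-/

set_option linter.dupNamespace false

noncomputable section

open scoped Manifold ContDiff Topology ENNReal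
open Set Filter Bundle

namespace Summit.FinalStateConjecture.FinalStateConjecture.Theorems.OneLockedExplosion

open Literature.Geometry.Lorentzian

/-! ## §T1 Transport of final state decompositions along time-orientation preserving isometries -/

section SpacetimeTransport

variable {𝓢₁ 𝓢₂ : Spacetime.{0} 4}
  (ψ : Diffeomorph (𝓡 4) (𝓡 4) 𝓢₁.carrier 𝓢₂.carrier ∞)
  (hiso : ∀ y, pullbackBilin (I := 𝓡 4) (I' := 𝓡 4) ψ 𝓢₂.metric.val y = 𝓢₁.metric.val y)
  (hτ : 𝓢₁.timeOrientation.PreservesTimeOrientation ψ 𝓢₂.timeOrientation)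

/-- A diffeomorphism is differentiable. [folklore] -/
theorem mdifferentiable_diffeomorph : MDifferentiable (𝓡 4) (𝓡 4) ψ :=
  ψ.contMDiff.mdifferentiable (by simp)

include hiso in
/-- The inverse of an isometric diffeomorphism is isometric: `(ψ⁻¹)^* g₁ = g₂` (chain rule for
pullbacks, O'Neill 1983, Ch. 3, p. 58). [folklore] -/
theorem isIsometry_symm :
    ∀ z, pullbackBilin (I := 𝓡 4) (I' := 𝓡 4) ψ.symm 𝓢₁.metric.val z = 𝓢₂.metric.val z := by
  have hid : (ψ : 𝓢₁.carrier → 𝓢₂.carrier) ∘ ψ.symm = id := funext ψ.apply_symm_apply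
  intro z
  have h1 : 𝓢₁.metric.val = pullbackBilin (I := 𝓡 4) (I' := 𝓡 4) ψ 𝓢₂.metric.val :=
    (funext hiso).symm
  rw [h1, ← pullbackBilin_comp (mdifferentiable_diffeomorph ψ) (mdifferentiable_diffeomorph ψ.symm),
    hid, pullbackBilin_id]

include hiso hτ in
/-- The inverse of a time-orientation preserving isometric diffeomorphism preserves the time
orientations (`dψ (dψ⁻¹ T₂) = T₂` is future-directed and `dψ` reflects future-directedness,
O'Neill 1983, Ch. 5, p. 145). [folklore] -/
theorem preservesTimeOrientation_symm :
    𝓢₂.timeOrientation.PreservesTimeOrientation ψ.symm 𝓢₁.timeOrientation := by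
  have hid : (ψ : 𝓢₁.carrier → 𝓢₂.carrier) ∘ ψ.symm = id := funext ψ.apply_symm_apply
  have hkey : ∀ (z : 𝓢₂.carrier) (w : TangentSpace (𝓡 4) z),
      mfderiv (𝓡 4) (𝓡 4) ψ (ψ.symm z) (mfderiv (𝓡 4) (𝓡 4) ψ.symm z w) = w := by
    intro z w
    have h := mfderiv_comp z (mdifferentiable_diffeomorph ψ (ψ.symm z))
      (mdifferentiable_diffeomorph ψ.symm z)
    rw [hid, mfderiv_id] at h
    exact (congrArg (fun L ↦ L w) h).symm
  intro z
  refine hτ.isFutureDirected_of_mfderiv hiso ?_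
  rw [hkey, ψ.apply_symm_apply]
  exact 𝓢₂.timeOrientation.isFutureDirected_vectorField z

/-- `ψ⁻¹(ψ(S)) = S`. [folklore] -/
theorem symm_image_image (S : Set 𝓢₁.carrier) : ψ.symm '' (ψ '' S) = S := by
  rw [Set.image_image]
  simp

/-- `ψ(ψ⁻¹(S)) = S`. [folklore] -/
theorem image_symm_image (S : Set 𝓢₂.carrier) : ψ '' (ψ.symm '' S) = S := by
  rw [Set.image_image]
  simp

include hiso hτ in
/-- **Causal futures are transported**: `ψ(J⁺(S)) = J⁺(ψ(S))` for a time-orientation preserving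
isometric diffeomorphism (both `ψ` and `ψ⁻¹` carry future causal curves to future causal curves,
O'Neill 1983, Ch. 14, pp. 402–403). [folklore] -/
theorem image_causalFuture_eq (S : Set 𝓢₁.carrier) :
    ψ '' 𝓢₁.metric.causalFuture 𝓢₁.timeOrientation S =
      𝓢₂.metric.causalFuture 𝓢₂.timeOrientation (ψ '' S) := by
  refine Set.Subset.antisymm
    (LorentzianMetric.image_causalFuture_subset (mdifferentiable_diffeomorph ψ) hτ hiso S) ?_
  intro q hq
  have h := LorentzianMetric.image_causalFuture_subset (mdifferentiable_diffeomorph ψ.symm)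
    (preservesTimeOrientation_symm ψ hiso hτ) (isIsometry_symm ψ hiso) (ψ '' S)
    (Set.mem_image_of_mem ψ.symm hq)
  rw [symm_image_image] at h
  exact ⟨ψ.symm q, h, ψ.apply_symm_apply q⟩

include hiso hτ in
/-- **Causal pasts are transported**: `ψ(J⁻(S)) = J⁻(ψ(S))` (time dual). [folklore] -/
theorem image_causalPast_eq (S : Set 𝓢₁.carrier) :
    ψ '' 𝓢₁.metric.causalPast 𝓢₁.timeOrientation S =
      𝓢₂.metric.causalPast 𝓢₂.timeOrientation (ψ '' S) := by
  refine Set.Subset.antisymm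
    (LorentzianMetric.image_causalPast_subset (mdifferentiable_diffeomorph ψ) hτ hiso S) ?_
  intro q hq
  have h := LorentzianMetric.image_causalPast_subset (mdifferentiable_diffeomorph ψ.symm)
    (preservesTimeOrientation_symm ψ hiso hτ) (isIsometry_symm ψ hiso) (ψ '' S)
    (Set.mem_image_of_mem ψ.symm hq)
  rw [symm_image_image] at h
  exact ⟨ψ.symm q, h, ψ.apply_symm_apply q⟩

end SpacetimeTransport

/-! ### Chronological futures and pasts -/

section Chronological

variable {E : Type*} [NormedAddCommGroup E] [NormedSpace ℝ E] {H : Type*} [TopologicalSpace H]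
  {I : ModelWithCorners ℝ E H} {M : Type*} [TopologicalSpace M] [ChartedSpace H M]
  [IsManifold I ∞ M]
  {E' : Type*} [NormedAddCommGroup E'] [NormedSpace ℝ E'] {H' : Type*} [TopologicalSpace H']
  {I' : ModelWithCorners ℝ E' H'} {N : Type*} [TopologicalSpace N] [ChartedSpace H' N]
  [IsManifold I' ∞ N]
  {m : ℕ∞ω} {g : LorentzianMetric I m M} {τ : TimeOrientation g}
  {gN : LorentzianMetric I' m N} {τN : TimeOrientation gN}

/-- `φ(I⁺(S)) ⊆ I⁺(φ(S))` for a time-orientation preserving isometric immersion `φ`. O'Neill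
1983, Ch. 14, pp. 402–403. [folklore] -/
theorem image_chronologicalFuture_subset {φ : N → M} (hφd : MDifferentiable I' I φ)
    (hτ : τN.PreservesTimeOrientation φ τ)
    (hφ : ∀ y, pullbackBilin (I := I) (I' := I') φ g.val y = gN.val y) (S : Set N) :
    φ '' gN.chronologicalFuture τN S ⊆ g.chronologicalFuture τ (φ '' S) := by
  rintro _ ⟨q, ⟨p, hp, γ, a, b, hab, hγ, hγa, hγb⟩, rfl⟩
  refine ⟨φ p, mem_image_of_mem φ hp, φ ∘ γ, a, b, hab,
    LorentzianMetric.IsFutureTimelikeCurveOn.comp_isIsometricImmersion hφd hτ hφ hγ, ?_, ?_⟩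
  · simp [hγa]
  · simp [hγb]

/-- `φ(I⁻(S)) ⊆ I⁻(φ(S))` for a time-orientation preserving isometric immersion `φ` (time
dual). O'Neill 1983, Ch. 14, p. 403. [folklore] -/
theorem image_chronologicalPast_subset {φ : N → M} (hφd : MDifferentiable I' I φ)
    (hτ : τN.PreservesTimeOrientation φ τ)
    (hφ : ∀ y, pullbackBilin (I := I) (I' := I') φ g.val y = gN.val y) (S : Set N) :
    φ '' gN.chronologicalPast τN S ⊆ g.chronologicalPast τ (φ '' S) :=
  image_chronologicalFuture_subset hφd hτ.reverse hφ S

end Chronological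

section SpacetimeTransport₂

variable {𝓢₁ 𝓢₂ : Spacetime.{0} 4}
  (ψ : Diffeomorph (𝓡 4) (𝓡 4) 𝓢₁.carrier 𝓢₂.carrier ∞)
  (hiso : ∀ y, pullbackBilin (I := 𝓡 4) (I' := 𝓡 4) ψ 𝓢₂.metric.val y = 𝓢₁.metric.val y)
  (hτ : 𝓢₁.timeOrientation.PreservesTimeOrientation ψ 𝓢₂.timeOrientation)

include hiso hτ in
/-- **Chronological pasts are transported**: `ψ(I⁻(S)) = I⁻(ψ(S))`. [folklore] -/
theorem image_chronologicalPast_eq (S : Set 𝓢₁.carrier) :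
    ψ '' 𝓢₁.metric.chronologicalPast 𝓢₁.timeOrientation S =
      𝓢₂.metric.chronologicalPast 𝓢₂.timeOrientation (ψ '' S) := by
  refine Set.Subset.antisymm
    (image_chronologicalPast_subset (mdifferentiable_diffeomorph ψ) hτ hiso S) ?_
  intro q hq
  have h := image_chronologicalPast_subset (mdifferentiable_diffeomorph ψ.symm)
    (preservesTimeOrientation_symm ψ hiso hτ) (isIsometry_symm ψ hiso) (ψ '' S)
    (Set.mem_image_of_mem ψ.symm hq)
  rw [symm_image_image] at h
  exact ⟨ψ.symm q, h, ψ.apply_symm_apply q⟩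

/-! ### Deviations, late charts -/

/-- The slab deviations of a chart are unchanged by composing with an isometric diffeomorphism
(`deviation_comp`). [folklore] -/
theorem deviationCk_comp (B : ModelBackground) {Ψ : B.domain → 𝓢₁.carrier}
    (hΨ : ContMDiff 𝓘(ℝ, E4) (𝓡 4) ∞ Ψ)
    (hiso : ∀ y, pullbackBilin (I := 𝓡 4) (I' := 𝓡 4) ψ 𝓢₂.metric.val y = 𝓢₁.metric.val y)
    (k : ℕ) (t : ℝ) :
    𝓢₂.deviationCk B (ψ ∘ Ψ) k t = 𝓢₁.deviationCk B Ψ k t := by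
  unfold Spacetime.deviationCk Spacetime.deviationExtend
  rw [Spacetime.deviation_comp B (mdifferentiable_diffeomorph ψ) hiso
    (hΨ.mdifferentiable (by simp))]

/-- The truncated slab deviations of a chart are unchanged by composing with an isometric
diffeomorphism (`deviation_comp`). [folklore] -/
theorem truncDeviationCk_comp (B : ModelBackground) {Ψ : B.domain → 𝓢₁.carrier}
    (hΨ : ContMDiff 𝓘(ℝ, E4) (𝓡 4) ∞ Ψ)
    (hiso : ∀ y, pullbackBilin (I := 𝓡 4) (I' := 𝓡 4) ψ 𝓢₂.metric.val y = 𝓢₁.metric.val y)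
    (k : ℕ) (R t : ℝ) :
    𝓢₂.truncDeviationCk B (ψ ∘ Ψ) k R t = 𝓢₁.truncDeviationCk B Ψ k R t := by
  unfold Spacetime.truncDeviationCk Spacetime.deviationExtend
  rw [Spacetime.deviation_comp B (mdifferentiable_diffeomorph ψ) hiso
    (hΨ.mdifferentiable (by simp))]

/-- Late-time charts push forward along a diffeomorphism: `ψ ∘ Ψ` is a late chart into `ψ(O)`.
[folklore] -/
theorem isLateChart_comp (B : ModelBackground) {O : Set 𝓢₁.carrier} {τ₀ : ℝ}
    {Ψ : B.domain → 𝓢₁.carrier} (h : 𝓢₁.IsLateChart B O τ₀ Ψ) :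
    𝓢₂.IsLateChart B (ψ '' O) τ₀ (ψ ∘ Ψ) where
  contMDiff := ψ.contMDiff.comp h.contMDiff
  isOpenEmbedding := ψ.toHomeomorph.isOpenEmbedding.comp h.isOpenEmbedding
  image_subset := by
    rw [Set.image_comp]
    exact Set.image_mono h.image_subset

end SpacetimeTransport₂

/-! ### The decomposition -/

section DecompositionTransport

variable {𝓢₁ 𝓢₂ : Spacetime.{0} 4}
  (ψ : Diffeomorph (𝓡 4) (𝓡 4) 𝓢₁.carrier 𝓢₂.carrier ∞)
  (hiso : ∀ y, pullbackBilin (I := 𝓡 4) (I' := 𝓡 4) ψ 𝓢₂.metric.val y = 𝓢₁.metric.val y)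
  (hτ : 𝓢₁.timeOrientation.PreservesTimeOrientation ψ 𝓢₂.timeOrientation)
  {O : Set 𝓢₁.carrier} {k : ℕ}

/-- **Transport of an `N`-Kerr final state decomposition along a time-orientation preserving
isometric diffeomorphism `ψ : 𝓢₁ ≃ 𝓢₂`.** Same `N`, parameters, motions, late time, excision
radii and flat domain; the charts are composed with `ψ`, the decomposed region becomes `ψ(O)`.
Every clause is preserved: the chart deviations are literally unchanged (`deviation_comp`),
images of model sets are carried by `ψ`, disjointness by injectivity, and the covering clause by
`ψ(J⁻(S)) = J⁻(ψ(S))`. [folklore] -/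
def transportDecomposition
    (hiso : ∀ y, pullbackBilin (I := 𝓡 4) (I' := 𝓡 4) ψ 𝓢₂.metric.val y = 𝓢₁.metric.val y)
    (hτ : 𝓢₁.timeOrientation.PreservesTimeOrientation ψ 𝓢₂.timeOrientation)
    (d : FinalStateDecomposition 𝓢₁ O k) :
    FinalStateDecomposition 𝓢₂ (ψ '' O) k where
  N := d.N
  mass := d.mass
  spin := d.spin
  mass_pos := d.mass_pos
  abs_spin_le_mass := d.abs_spin_le_mass
  motion := d.motion
  τ₀ := d.τ₀
  chart i := ψ ∘ d.chart i
  isLateChart i := isLateChart_comp ψ _ (d.isLateChart i)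
  tendsto_truncDeviationCk i R :=
    (d.tendsto_truncDeviationCk i R).congr fun t ↦
      (truncDeviationCk_comp ψ _ (d.isLateChart i).contMDiff hiso k R t).symm
  exists_pairwise_disjoint R := by
    obtain ⟨τ₁, h⟩ := d.exists_pairwise_disjoint R
    refine ⟨τ₁, fun i j hij ↦ ?_⟩
    have hd := h hij
    dsimp only [Function.onFun] at hd ⊢
    rw [Set.image_comp, Set.image_comp]
    have hinj : Function.Injective ψ := ψ.injective
    exact Set.disjoint_image_of_injective hinj hd
  excision := d.excision
  tendsto_excision_div := d.tendsto_excision_div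
  flatDomain := d.flatDomain
  setOf_lt_excision_subset_flatDomain := d.setOf_lt_excision_subset_flatDomain
  flatChart := ψ ∘ d.flatChart
  isLateChart_flat := isLateChart_comp ψ _ d.isLateChart_flat
  tendsto_deviationCk_flat :=
    d.tendsto_deviationCk_flat.congr fun t ↦
      (deviationCk_comp ψ _ d.isLateChart_flat.contMDiff hiso k t).symm
  diff_subset_causalPast := by
    have h := d.diff_subset_causalPast
    have hinj : Function.Injective ψ := ψ.injective
    simp only [Set.image_comp, ← Set.image_iUnion, ← Set.image_union]
    rw [← Set.image_sdiff hinj, ← image_causalPast_eq ψ hiso hτ]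
    exact Set.image_mono h

/-- The transport keeps the number of holes. [folklore] -/
@[simp] theorem transportDecomposition_N (d : FinalStateDecomposition 𝓢₁ O k) :
    (transportDecomposition ψ hiso hτ d).N = d.N := rfl

/-- The transport keeps the masses. [folklore] -/
@[simp] theorem transportDecomposition_mass (d : FinalStateDecomposition 𝓢₁ O k) :
    (transportDecomposition ψ hiso hτ d).mass = d.mass := rfl

/-- The transport keeps the spins. [folklore] -/
@[simp] theorem transportDecomposition_spin (d : FinalStateDecomposition 𝓢₁ O k) :
    (transportDecomposition ψ hiso hτ d).spin = d.spin := rfl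

/-- The transport keeps the late time. [folklore] -/
@[simp] theorem transportDecomposition_τ₀ (d : FinalStateDecomposition 𝓢₁ O k) :
    (transportDecomposition ψ hiso hτ d).τ₀ = d.τ₀ := rfl

/-- The charted late region of the transport is the `ψ`-image of the charted late region.
[folklore] -/
theorem charted_transportDecomposition (d : FinalStateDecomposition 𝓢₁ O k) :
    (transportDecomposition ψ hiso hτ d).charted = ψ '' d.charted := by
  show (ψ ∘ d.flatChart) '' _ ∪ ⋃ i, (ψ ∘ d.chart i) '' _ =
    ψ '' (d.flatChart '' _ ∪ ⋃ i, d.chart i '' _)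
  rw [Set.image_union, Set.image_iUnion]
  simp only [Set.image_comp]
  rfl

/-- The certified late regions of the transport are the `ψ`-images of those of `d`. [folklore] -/
theorem certifiedLate_transportDecomposition (d : FinalStateDecomposition 𝓢₁ O k)
    (R : Fin d.N → ℝ → ℝ) (τ₁ : ℝ) :
    Summit.FinalStateConjecture.certifiedLate (transportDecomposition ψ hiso hτ d) R τ₁ =
      ψ '' Summit.FinalStateConjecture.certifiedLate d R τ₁ := by
  show (ψ ∘ d.flatChart) '' _ ∪ ⋃ i, (ψ ∘ d.chart i) '' _ =
    ψ '' (d.flatChart '' _ ∪ ⋃ i, d.chart i '' _)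
  rw [Set.image_union, Set.image_iUnion]
  simp only [Set.image_comp]
  rfl

/-- The certified slabs of the transport are the `ψ`-images of those of `d`. [folklore] -/
theorem certifiedSlab_transportDecomposition (d : FinalStateDecomposition 𝓢₁ O k)
    (R : Fin d.N → ℝ → ℝ) (τ₁ : ℝ) :
    Summit.FinalStateConjecture.certifiedSlab (transportDecomposition ψ hiso hτ d) R τ₁ =
      ψ '' Summit.FinalStateConjecture.certifiedSlab d R τ₁ := by
  show (ψ ∘ d.flatChart) '' _ ∪ ⋃ i, (ψ ∘ d.chart i) '' _ =
    ψ '' (d.flatChart '' _ ∪ ⋃ i, d.chart i '' _)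
  rw [Set.image_union, Set.image_iUnion]
  simp only [Set.image_comp]
  rfl

include hiso hτ in
/-- **Exhaustiveness of the charts is transported** (the summit's clause
`Summit.FinalStateConjecture.HasExhaustiveCharts`, human ruling F2): same near-zone radii `Rᵢ`,
growing-slab deviations unchanged, and the covering of `ψ(O)` by the causal past of the
certified slabs follows from `ψ(J⁻(S)) = J⁻(ψ(S))`. [folklore] -/
theorem hasExhaustiveCharts_transportDecomposition (d : FinalStateDecomposition 𝓢₁ O k)
    (h : Summit.FinalStateConjecture.HasExhaustiveCharts d) :
    Summit.FinalStateConjecture.HasExhaustiveCharts (transportDecomposition ψ hiso hτ d) := by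
  -- Statement re-type T2 (2026-08-16): `HasExhaustiveCharts` now also records honest radii
  -- (`Rᵢ → ∞`, `Rᵢ(τ) ≥ max (r₊(Mᵢ, aᵢ)) 0 + 1`); the transport keeps `N`, masses and spins, so that
  -- clause is carried over verbatim.
  obtain ⟨R, hR₀, hR, hcov⟩ := h
  refine ⟨R, fun i ↦ hR₀ i, fun i ↦ ?_, fun τ₁ hτ₁ ↦ ?_⟩
  · exact (hR i).congr fun t ↦
      (truncDeviationCk_comp ψ _ (d.isLateChart i).contMDiff hiso k (R i t) t).symm
  · have hinj : Function.Injective ψ := ψ.injective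
    rw [certifiedLate_transportDecomposition, certifiedSlab_transportDecomposition,
      ← Set.image_sdiff hinj, ← image_causalPast_eq ψ hiso hτ]
    exact Set.image_mono (hcov τ₁ hτ₁)

end DecompositionTransport

/-- **Exhaustiveness is transported** (binder-free form of `hasExhaustiveCharts_transportDecomposition`,
the registered helper of this file). [folklore] -/
theorem hasExhaustiveCharts_transport :
    ∀ (𝓢₁ 𝓢₂ : Spacetime.{0} 4) (ψ : Diffeomorph (𝓡 4) (𝓡 4) 𝓢₁.carrier 𝓢₂.carrier ∞)
      (hiso : ∀ y, pullbackBilin (I := 𝓡 4) (I' := 𝓡 4) ψ 𝓢₂.metric.val y = 𝓢₁.metric.val y)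
      (hτ : 𝓢₁.timeOrientation.PreservesTimeOrientation ψ 𝓢₂.timeOrientation)
      (O : Set 𝓢₁.carrier) (k : ℕ) (d : FinalStateDecomposition 𝓢₁ O k),
      Summit.FinalStateConjecture.HasExhaustiveCharts d →
        Summit.FinalStateConjecture.HasExhaustiveCharts (transportDecomposition ψ hiso hτ d) :=
  fun _ _ ψ hiso hτ _ _ d h ↦ hasExhaustiveCharts_transportDecomposition ψ hiso hτ d h

end Summit.FinalStateConjecture.FinalStateConjecture.Theorems.OneLockedExplosion

end
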